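import Summits.QuantumFields.BalabanUV.Beta.BorderedHessianRooted

/-!
# The bordered Hessian with a BORDER SLOT: `bhKOf lin N` (constraint blocks = ANY linearised averaging `lin` read on bond indicators);
# `bhKAt ρ N` and `bhK N` as its two instances, and the slot-generic bookkeeping (entries, parity, support, bounds, decay, comb-stability)
# (β sub-cell, row BETA-an2 = BINDER-OWNERS row D1, table-slot refactor «SLOT-BHK» of ruling R-D1-g25-2 (3); seat t4-ne9-formalise-leaf-03 gen 34)

HONEST FRAMING (cell charter, verbatim): «discharging BetaPertH makes Balaban's UV stability UNCONDITIONAL — a real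
constructive-QFT result; it is NOT the continuum limit and NOT the Clay problem.»  DERIVED cell leaf (pub-balaban β sub-cell); no
statement of Bałaban's papers is typed here, no `[cite:]` tag, no `Prop` fact; it instantiates no binder of the β-function wall by
itself.  NOT D1, NOT `BetaPertH`; NOT continuum; NOT Clay.

## Why

The row-D1 owner's re-instantiation route for the literal `JsB12Sym` (ruling R-D1-g25-2 (3), an3's LETTER-AUDIT §4) asks that every
definition which HARD-WIRES a comb table get a TABLE ∕ OPERATOR PARAMETER in a new sibling module, with the landed object recovered by
`rfl`, so that every table-generic («V1») lemma is literally SHARED between the frozen comb template and the symmetrised tables.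
`BorderedHessianRooted.bhKAt ρ N` hard-wires an1's ROOTED linearised averaging `linAvgAt ρ · N` in its two border blocks; `bhK N` hard-wires
the straight `𝒬_N` (`contourSum N`, `contourSumAdj N`).  This file is the border slot.

## What is here

* §1 **`bhKOf d lin N`** — `bhK`∕`bhKAt` with the border read through an ARBITRARY operator
  `lin : Form1 (d+1) ℝ → Fin (d+1) → (Fin (d+1) → ℤ) → ℝ` (a 1-form ↦ its value at the coarse bond `(κ, y′)`):
  `(inr κ x; inl l y) := [proj N x = 0]·lin (delta1 l y) κ (quo N x)`, `(inl κ x; inr l y) := −[proj N y = 0]·lin (delta1 κ x) l (quo N y)`,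
  field–field block the windowed `d*d` of `bhK`, multiplier–multiplier block `0`; entries; **bridges** `bhKOf_linAvgAt : bhKOf d (linAvgAt ρ · N) N
  = bhKAt d ρ N` (`rfl`) and `bhKOf_contourSum : bhKOf d (contourSum N) N = bhK N` (the `𝒬 ↔ 𝒬ᵀ` duality `contourSum_delta1_eq_contourSumAdj`).
* §2 slot-generic structure with NO hypothesis on `lin`: multiplier rows∕columns vanish off the coarse sublattice; **`trK_bhKOf : trK (bhKOf d lin N)
  = sgnK (bhKOf d lin N)`** (the two border blocks are each other's negative transpose BY CONSTRUCTION; ff block by `trK_bhK`).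
* §3 under a SUPPORT binder `hsupp` (a non-zero border entry at a coarse point forces the window `cube (2N)`) and a BOUND binder `hbd`
  (`|lin (delta1 l y) κ y′| ≤ B`): `bhKOf_eq_zero_of_not_mem_cube`, `abs_bhKOf_le (≤ cBH d N + B)`, `decays_bhKOf` (every rate), `spr_bhKOf`; the two
  binders are DISCHARGED for both instances by lemmas already in the tree (`contourSum_delta_ne_zero` ∕ `abs_contourSum_delta_le`;
  `abs_linAvgAt_delta1_le` and `supp_linAvgAt` here = `linAvgAt_delta1_eq_zero_of_not_near` + `sub_mem_cube_of_near`).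
* §4 SLOT DIFFERENCES: `bhKOf lin N − bhKOf lin′ N` lives on the border blocks and reads `lin − lin′` there (`bhKOf_sub_inl_inr`∕`_inr_inl`;
  `_inl_inl`∕`_inr_inr` vanish; `bhKOf_sub_ne_zero`); if the two
  operators AGREE on the indicators of non-comb bonds then the difference is comb-supported (`combSupported_bhKOf_sub_of_agree` — §4 of
  `BorderedHessianRooted` with both averagings abstracted) and **`relInv_bhKOf_of_agree`**: `RelInv A (bhKOf lin N) (axEc ρ N)` transports to
  `RelInv A (bhKOf lin′ N) (axEc ρ N)` (`relInv_of_combSupported_sub` BY NAME).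

NOT here: a slot for `bhKStepAt`; any `JsB12Sym` instance (the owner's ∕ an1's symmetrised tables fill `lin`); reflection laws of the border
(`refK_bhKAt_inl_inr` is table-specific, V1-by-averaging).  All declarations `[folklore]`; axioms standard.  Provenance: b2b-balaban β sub-cell,
seat `b2b-balaban-t4-ne9-formalise-leaf-03` gen 34 (cross-cell idle-seat kernel row), 2026-08-21 (v1); over `BorderedHessianRooted` (an2 gen 14),
`BorderedHessianKernel`∕`BorderedHessianSymmetry` (an2), an1's `AveragingContoursRooted` BY NAME; no existing file touched.
-/

open Finset
open scoped BigOperators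
open Literature.Probability.LatticeModels (TorusSite Torus.proj Torus.proj_apply)
open Literature.MathematicalPhysics.QuantumFieldTheory
open Literature.MathematicalPhysics.QuantumFieldTheory.Balaban1983to89
open Literature.MathematicalPhysics.QuantumFieldTheory.Balaban1983to89.Beta
open B12Sec2to5 (l1 l1_nonneg)
open ExpKernelCalculus (MKer Decays BiLoc comp tr shiftK)
open AffineAveraging (Form0 Form1 Form2 box toSite unitVec unitVec_apply dz curv curvAdj codiff₁ contourSum)
open AffineReproduction (contourSumAdj)
open AveragingContoursRooted (linAvgAt)
open AveragingHessianKernels (Bond single single_apply Near ell)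
open KKTFluctuationKernel (delta1 delta1_apply)
open LatticeForm (quo)
open OneStepResolventKernel (Fib KInv quo_zsmul eq_zsmul_quo_of_proj proj_zsmul)
open HessKerRate (decays_sub)
open Summit.QuantumFields.BalabanUV.Beta.TameKernelCalculus
open Summit.QuantumFields.BalabanUV.Beta.ChartConjugationRelative (RelInv)
open Summit.QuantumFields.BalabanUV.Beta.AxialDressingRooted (cube mem_cube l1_le_of_mem_cube one_le_of_neZero IsCombBondAt axEc spr_axEc
  spr_comp)

namespace Summit.QuantumFields.BalabanUV.Beta.BorderedHessian

noncomputable section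

variable {d : ℕ}

/-! ## §1 The bordered Hessian over a border slot, and its two instances -/

section Def
variable (d)

open Classical in
/-- [folklore] **THE BORDERED HESSIAN WITH A BORDER SLOT** `bhKOf d lin N`: the packed kernel `[[d*d, −linᵀ],[lin, 0]]` whose constraint
blocks read an ARBITRARY linearised-averaging operator `lin : Form1 (d+1) ℝ → Fin (d+1) → (Fin (d+1) → ℤ) → ℝ` on bond indicators —
`(inr κ x; inl l y) = [proj N x = 0]·lin (delta1 l y) κ (quo N x)`, `(inl κ x; inr l y) = −[proj N y = 0]·lin (delta1 κ x) l (quo N y)`; the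
field–field block is the windowed `d*d` of `bhK`, the multiplier–multiplier block `0`.  Instances: `lin := linAvgAt ρ · N` (`bhKAt`, `rfl`),
`lin := contourSum N` (`bhK`). -/
def bhKOf (lin : Form1 (d + 1) ℝ → Fin (d + 1) → (Fin (d + 1) → ℤ) → ℝ) (N : ℕ) : MKer (d + 1) (Fib d) :=
  fun x y a b =>
    match a, b with
    | Sum.inl κ, Sum.inl l => if y - x ∈ cube (d + 1) 2 then curvAdj (curv (delta1 l y)) κ x else 0
    | Sum.inl κ, Sum.inr l => if Torus.proj N y = 0 then -(lin (delta1 κ x) l (quo N y)) else 0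
    | Sum.inr κ, Sum.inl l => if Torus.proj N x = 0 then lin (delta1 l y) κ (quo N x) else 0
    | Sum.inr _, Sum.inr _ => 0

variable {d} (lin : Form1 (d + 1) ℝ → Fin (d + 1) → (Fin (d + 1) → ℤ) → ℝ) (N : ℕ)

/-- [folklore] The field–field block of `bhKOf` is that of `bhK` (slot-free). -/
theorem bhKOf_inl_inl (x y : Fin (d + 1) → ℤ) (κ l : Fin (d + 1)) :
    bhKOf d lin N x y (Sum.inl κ) (Sum.inl l) = bhK N x y (Sum.inl κ) (Sum.inl l) := rfl

open Classical in
/-- [folklore] Field–multiplier entry of `bhKOf`: `−[proj N y = 0]·lin (delta1 κ x) l (quo N y)`. -/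
theorem bhKOf_inl_inr (x y : Fin (d + 1) → ℤ) (κ l : Fin (d + 1)) :
    bhKOf d lin N x y (Sum.inl κ) (Sum.inr l) = if Torus.proj N y = 0 then -(lin (delta1 κ x) l (quo N y)) else 0 := rfl

open Classical in
/-- [folklore] Multiplier–field entry of `bhKOf`: `[proj N x = 0]·lin (delta1 l y) κ (quo N x)`. -/
theorem bhKOf_inr_inl (x y : Fin (d + 1) → ℤ) (κ l : Fin (d + 1)) :
    bhKOf d lin N x y (Sum.inr κ) (Sum.inl l) = if Torus.proj N x = 0 then lin (delta1 l y) κ (quo N x) else 0 := rfl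

/-- [folklore] Multiplier–multiplier entry of `bhKOf` vanishes. -/
theorem bhKOf_inr_inr (x y : Fin (d + 1) → ℤ) (κ l : Fin (d + 1)) : bhKOf d lin N x y (Sum.inr κ) (Sum.inr l) = 0 := rfl

/-- [folklore] **BRIDGE (ROOTED INSTANCE), by `rfl`:** the slot filled with an1's rooted linearised averaging `linAvgAt ρ · N` is
`BorderedHessianRooted.bhKAt ρ N`. -/
theorem bhKOf_linAvgAt (ρ : Fin (d + 1) → ℤ) : bhKOf d (fun A => linAvgAt ρ A N) N = bhKAt d ρ N := rfl

/-- [folklore] **BRIDGE (STRAIGHT INSTANCE):** the slot filled with the straight averaging `𝒬_N = contourSum N` is `BorderedHessianKernel.bhK N`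
(the field–multiplier entry of `bhK` is written with `𝒬ᵀ_N`; `contourSum_delta1_eq_contourSumAdj` is the duality). -/
theorem bhKOf_contourSum [NeZero N] : bhKOf d (contourSum N) N = bhK (d := d) N := by
  funext x y a b
  rcases a with κ | κ <;> rcases b with l | l
  · rfl
  · rw [bhKOf_inl_inr, bhK_inl_inr]
    split_ifs with hy
    · rw [contourSum_delta1_eq_contourSumAdj]
    · rfl
  · rfl
  · rfl

end Def

/-! ## §2 Slot-generic structure (no hypothesis on the slot) -/

section Structure
variable (lin : Form1 (d + 1) ℝ → Fin (d + 1) → (Fin (d + 1) → ℤ) → ℝ) (N : ℕ)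

/-- [folklore] Multiplier ROWS of `bhKOf` vanish off the coarse sublattice. -/
theorem bhKOf_inr_row_off {x : Fin (d + 1) → ℤ} (hx : Torus.proj N x ≠ 0) (y : Fin (d + 1) → ℤ) (κ : Fin (d + 1)) (b : Fib d) :
    bhKOf d lin N x y (Sum.inr κ) b = 0 := by
  rcases b with l | l
  · rw [bhKOf_inr_inl, if_neg hx]
  · rfl

/-- [folklore] Multiplier COLUMNS of `bhKOf` vanish off the coarse sublattice. -/
theorem bhKOf_inr_col_off {y : Fin (d + 1) → ℤ} (hy : Torus.proj N y ≠ 0) (x : Fin (d + 1) → ℤ) (a : Fib d) (l : Fin (d + 1)) :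
    bhKOf d lin N x y a (Sum.inr l) = 0 := by
  rcases a with κ | κ
  · rw [bhKOf_inl_inr, if_neg hy]
  · rfl

/-- [folklore] **`bhKOf d lin N` IS sgn-SYMMETRIC FOR EVERY SLOT**: `trK (bhKOf d lin N) = sgnK (bhKOf d lin N)` — the ff block is symmetric
(`trK_bhK`), the two border blocks are each other's negative transpose by construction, the mm block is `0`. -/
theorem trK_bhKOf [NeZero N] : trK (bhKOf d lin N) = sgnK (bhKOf d lin N) := by
  funext x y a b
  rw [trK_apply, sgnK_apply]
  rcases a with κ | κ <;> rcases b with l | l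
  · have e := congrFun (congrFun (congrFun (congrFun (trK_bhK (d := d) N) x) y) (Sum.inl κ)) (Sum.inl l)
    rw [trK_apply, sgnK_apply] at e
    rw [bhKOf_inl_inl, bhKOf_inl_inl]
    exact e
  · rw [bhKOf_inr_inl, bhKOf_inl_inr, sgnF_inl, sgnF_inr]
    split_ifs <;> ring
  · rw [bhKOf_inl_inr, bhKOf_inr_inl, sgnF_inr, sgnF_inl]
    split_ifs <;> ring
  · rw [bhKOf_inr_inr, bhKOf_inr_inr]; ring

end Structure

/-! ## §3 Support and bound binders on the slot ⟹ finite range, bounded entries, decay, spread -/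

section Bounds
variable {lin : Form1 (d + 1) ℝ → Fin (d + 1) → (Fin (d + 1) → ℤ) → ℝ} {N : ℕ}

/-- [folklore] The window `cube` is symmetric under `v ↦ −v` (as `y − x ↦ x − y`). -/
theorem sub_mem_cube_symm {n M : ℕ} {x y : Fin n → ℤ} (h : x - y ∈ cube n M) : y - x ∈ cube n M :=
  (sub_mem_cube_comm x y).2 h

/-- [folklore] **FINITE RANGE UNDER THE SUPPORT BINDER**: if a non-zero border value `lin (delta1 l y) κ (quo N x)` at a coarse `x` forces
`y − x ∈ cube (2N)` (`hsupp`), then `bhKOf d lin N x y a b = 0` unless `y − x ∈ cube (2N)` (`N ≥ 1`; ff block by `bhK_eq_zero_of_not_mem_cube`). -/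
theorem bhKOf_eq_zero_of_not_mem_cube (hN : 1 ≤ N)
    (hsupp : ∀ (l : Fin (d + 1)) (y : Fin (d + 1) → ℤ) (κ : Fin (d + 1)) (x : Fin (d + 1) → ℤ),
      Torus.proj N x = 0 → lin (delta1 l y) κ (quo N x) ≠ 0 → y - x ∈ cube (d + 1) (2 * N))
    {x y : Fin (d + 1) → ℤ} (hxy : y - x ∉ cube (d + 1) (2 * N)) (a b : Fib d) : bhKOf d lin N x y a b = 0 := by
  rcases a with κ | κ <;> rcases b with l | l
  · rw [bhKOf_inl_inl]; exact bhK_eq_zero_of_not_mem_cube hN hxy _ _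
  · rw [bhKOf_inl_inr]
    split_ifs with hy
    · rw [neg_eq_zero]
      by_contra hne
      exact hxy (sub_mem_cube_symm (hsupp κ x l y hy hne))
    · rfl
  · rw [bhKOf_inr_inl]
    split_ifs with hx
    · by_contra hne
      exact hxy (hsupp l y κ x hx hne)
    · rfl
  · rfl

/-- [folklore] **UNIFORM ENTRY BOUND UNDER THE BOUND BINDER**: `|lin (delta1 l y) κ y′| ≤ B` (`hbd`, `0 ≤ B`) gives
`|bhKOf d lin N x y a b| ≤ cBH d N + B` (ff block by `abs_bhK_le`). -/
theorem abs_bhKOf_le {B : ℝ} (hB : 0 ≤ B)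
    (hbd : ∀ (l : Fin (d + 1)) (y : Fin (d + 1) → ℤ) (κ : Fin (d + 1)) (y' : Fin (d + 1) → ℤ), |lin (delta1 l y) κ y'| ≤ B)
    (x y : Fin (d + 1) → ℤ) (a b : Fib d) : |bhKOf d lin N x y a b| ≤ cBH d N + B := by
  have h1 : (0 : ℝ) ≤ cBH d N := cBH_nonneg d N
  rcases a with κ | κ <;> rcases b with l | l
  · rw [bhKOf_inl_inl]; exact (abs_bhK_le N x y _ _).trans (le_add_of_nonneg_right hB)
  · rw [bhKOf_inl_inr]
    split_ifs
    · rw [abs_neg]; exact (hbd κ x l _).trans (le_add_of_nonneg_left h1)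
    · rw [abs_zero]; exact add_nonneg h1 hB
  · rw [bhKOf_inr_inl]
    split_ifs
    · exact (hbd l y κ _).trans (le_add_of_nonneg_left h1)
    · rw [abs_zero]; exact add_nonneg h1 hB
  · rw [bhKOf_inr_inr, abs_zero]; exact add_nonneg h1 hB

/-- [folklore] **`bhKOf d lin N` DECAYS AT EVERY RATE** under the two binders (finite range `cube (2N)`, entries `≤ cBH d N + B`):
constant `(cBH d N + B)·e^{δ(d+1)(2N)}`. -/
theorem decays_bhKOf (hN : 1 ≤ N)
    (hsupp : ∀ (l : Fin (d + 1)) (y : Fin (d + 1) → ℤ) (κ : Fin (d + 1)) (x : Fin (d + 1) → ℤ),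
      Torus.proj N x = 0 → lin (delta1 l y) κ (quo N x) ≠ 0 → y - x ∈ cube (d + 1) (2 * N))
    {B : ℝ} (hB : 0 ≤ B)
    (hbd : ∀ (l : Fin (d + 1)) (y : Fin (d + 1) → ℤ) (κ : Fin (d + 1)) (y' : Fin (d + 1) → ℤ), |lin (delta1 l y) κ y'| ≤ B)
    {δ : ℝ} (hδ : 0 ≤ δ) :
    Decays (bhKOf d lin N) ((cBH d N + B) * Real.exp (δ * (((d : ℝ) + 1) * (2 * N)))) δ := by
  have h0 : 0 ≤ cBH d N + B := add_nonneg (cBH_nonneg d N) hB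
  intro x y a b
  by_cases hxy : y - x ∈ cube (d + 1) (2 * N)
  · have hl : l1 (x - y) ≤ ((d : ℝ) + 1) * (2 * N) := by
      rw [ExpKernelCalculus.l1_sub_symm]
      have := l1_le_of_mem_cube hxy
      push_cast at this
      linarith
    calc |bhKOf d lin N x y a b| ≤ (cBH d N + B) * 1 := by rw [mul_one]; exact abs_bhKOf_le hB hbd x y a b
      _ ≤ (cBH d N + B) * (Real.exp (δ * (((d : ℝ) + 1) * (2 * N))) * Real.exp (-δ * l1 (x - y))) := by
          refine mul_le_mul_of_nonneg_left ?_ h0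
          rw [← Real.exp_add]
          exact Real.one_le_exp (by nlinarith)
      _ = (cBH d N + B) * Real.exp (δ * (((d : ℝ) + 1) * (2 * N))) * Real.exp (-δ * l1 (x - y)) := by ring
  · rw [bhKOf_eq_zero_of_not_mem_cube hN hsupp hxy, abs_zero]
    exact mul_nonneg (mul_nonneg h0 (Real.exp_pos _).le) (Real.exp_pos _).le

/-- [folklore] **`bhKOf d lin N` IS SPREAD** under the two binders. -/
theorem spr_bhKOf (hN : 1 ≤ N)
    (hsupp : ∀ (l : Fin (d + 1)) (y : Fin (d + 1) → ℤ) (κ : Fin (d + 1)) (x : Fin (d + 1) → ℤ),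
      Torus.proj N x = 0 → lin (delta1 l y) κ (quo N x) ≠ 0 → y - x ∈ cube (d + 1) (2 * N))
    {B : ℝ} (hB : 0 ≤ B)
    (hbd : ∀ (l : Fin (d + 1)) (y : Fin (d + 1) → ℤ) (κ : Fin (d + 1)) (y' : Fin (d + 1) → ℤ), |lin (delta1 l y) κ y'| ≤ B) :
    Spr (bhKOf d lin N) :=
  ⟨_, 1, one_pos, decays_bhKOf hN hsupp hB hbd zero_le_one⟩

/-! ### The two binders for the two instances: the straight slot `contourSum N` has `hsupp` = `contourSum_delta_ne_zero` and `hbd` =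
`abs_contourSum_delta_le` (`B = N^{d+1}·N`) VERBATIM (`BorderedHessianKernel`); the rooted slot `linAvgAt (toSite r) · N` has `hbd` =
`abs_linAvgAt_delta1_le` (`B = N^{d+1}·ℓ`, `BorderedHessianRooted`) VERBATIM and `hsupp` = the following two-line combination. -/

/-- [folklore] SUPPORT BINDER FOR THE ROOTED SLOT `linAvgAt (toSite r) · N` (in-block root): a non-zero value forces `Near N (quo N x) y`
(`linAvgAt_delta1_eq_zero_of_not_near`), hence the window (`sub_mem_cube_of_near`). -/
theorem supp_linAvgAt [NeZero N] {r : Fin (d + 1) → ℕ} (hr : r ∈ box (d + 1) N) (l : Fin (d + 1)) (y : Fin (d + 1) → ℤ)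
    (κ : Fin (d + 1)) (x : Fin (d + 1) → ℤ) (hx : Torus.proj N x = 0) (h : linAvgAt (toSite r) (delta1 l y) N κ (quo N x) ≠ 0) :
    y - x ∈ cube (d + 1) (2 * N) := by
  by_cases hnear : Near N (quo N x) y
  · exact sub_mem_cube_of_near hx hnear
  · exact absurd (linAvgAt_delta1_eq_zero_of_not_near hr l κ hnear) h

end Bounds

/-! ## §4 Slot differences: border-supported, comb-supported on agreement off the comb, and comb-stability of `RelInv` -/

section Diff
variable {lin lin' : Form1 (d + 1) ℝ → Fin (d + 1) → (Fin (d + 1) → ℤ) → ℝ} {N : ℕ}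

/-- [folklore] The ff block of a slot difference vanishes. -/
theorem bhKOf_sub_inl_inl (x y : Fin (d + 1) → ℤ) (κ l : Fin (d + 1)) :
    (bhKOf d lin N - bhKOf d lin' N) x y (Sum.inl κ) (Sum.inl l) = 0 := by
  rw [Pi.sub_apply, Pi.sub_apply, Pi.sub_apply, Pi.sub_apply, bhKOf_inl_inl, bhKOf_inl_inl, sub_self]

/-- [folklore] The mm block of a slot difference vanishes. -/
theorem bhKOf_sub_inr_inr (x y : Fin (d + 1) → ℤ) (κ l : Fin (d + 1)) :
    (bhKOf d lin N - bhKOf d lin' N) x y (Sum.inr κ) (Sum.inr l) = 0 := by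
  rw [Pi.sub_apply, Pi.sub_apply, Pi.sub_apply, Pi.sub_apply, bhKOf_inr_inr, bhKOf_inr_inr, sub_self]

open Classical in
/-- [folklore] The field–multiplier entry of a slot difference reads `−(lin − lin′)` on the indicator `delta1 κ x`. -/
theorem bhKOf_sub_inl_inr (x y : Fin (d + 1) → ℤ) (κ l : Fin (d + 1)) :
    (bhKOf d lin N - bhKOf d lin' N) x y (Sum.inl κ) (Sum.inr l) =
      if Torus.proj N y = 0 then -(lin (delta1 κ x) l (quo N y) - lin' (delta1 κ x) l (quo N y)) else 0 := by
  rw [Pi.sub_apply, Pi.sub_apply, Pi.sub_apply, Pi.sub_apply, bhKOf_inl_inr, bhKOf_inl_inr]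
  split_ifs <;> ring

open Classical in
/-- [folklore] The multiplier–field entry of a slot difference reads `lin − lin′` on the indicator `delta1 l y`. -/
theorem bhKOf_sub_inr_inl (x y : Fin (d + 1) → ℤ) (κ l : Fin (d + 1)) :
    (bhKOf d lin N - bhKOf d lin' N) x y (Sum.inr κ) (Sum.inl l) =
      if Torus.proj N x = 0 then lin (delta1 l y) κ (quo N x) - lin' (delta1 l y) κ (quo N x) else 0 := by
  rw [Pi.sub_apply, Pi.sub_apply, Pi.sub_apply, Pi.sub_apply, bhKOf_inr_inl, bhKOf_inr_inl]
  split_ifs <;> ring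

/-- [folklore] **A NON-ZERO ENTRY OF A SLOT DIFFERENCE IS A BORDER ENTRY WHERE THE TWO OPERATORS DIFFER ON THE FIELD LEG'S INDICATOR**:
either `a = inl κ` with `lin (delta1 κ x) ≠ lin′ (delta1 κ x)`, or `b = inl l` with `lin (delta1 l y) ≠ lin′ (delta1 l y)`. -/
theorem bhKOf_sub_ne_zero {x y : Fin (d + 1) → ℤ} {a b : Fib d} (hne : (bhKOf d lin N - bhKOf d lin' N) x y a b ≠ 0) :
    (∃ κ, a = Sum.inl κ ∧ lin (delta1 κ x) ≠ lin' (delta1 κ x)) ∨ (∃ l, b = Sum.inl l ∧ lin (delta1 l y) ≠ lin' (delta1 l y)) := by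
  rcases a with κ | κ <;> rcases b with l | l
  · exact absurd (bhKOf_sub_inl_inl x y κ l) hne
  · refine Or.inl ⟨κ, rfl, fun h => hne ?_⟩
    rw [bhKOf_sub_inl_inr, h, sub_self, neg_zero]
    split_ifs <;> rfl
  · refine Or.inr ⟨l, rfl, fun h => hne ?_⟩
    rw [bhKOf_sub_inr_inl, h, sub_self]
    split_ifs <;> rfl
  · exact absurd (bhKOf_sub_inr_inr x y κ l) hne

/-- [folklore] **AGREEMENT OFF THE COMB ⟹ THE SLOT DIFFERENCE IS COMB-SUPPORTED**: if `lin` and `lin′` agree on the indicator of every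
NON-comb bond (root `ρ`, blocking `N`), every non-zero entry of `bhKOf lin N − bhKOf lin′ N` has a field leg on a comb bond — §4
`combSupported_bhKAt_sub_bhK` of `BorderedHessianRooted` with both averagings abstracted. -/
theorem combSupported_bhKOf_sub_of_agree {ρ : Fin (d + 1) → ℤ}
    (h : ∀ (κ : Fin (d + 1)) (x : Fin (d + 1) → ℤ), ¬ IsCombBondAt ρ N κ x → lin (delta1 κ x) = lin' (delta1 κ x))
    (x y : Fin (d + 1) → ℤ) (a b : Fib d) (hne : (bhKOf d lin N - bhKOf d lin' N) x y a b ≠ 0) :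
    (∃ κ, a = Sum.inl κ ∧ IsCombBondAt ρ N κ x) ∨ (∃ l, b = Sum.inl l ∧ IsCombBondAt ρ N l y) := by
  rcases bhKOf_sub_ne_zero hne with ⟨κ, rfl, hκ⟩ | ⟨l, rfl, hl⟩
  · by_cases hc : IsCombBondAt ρ N κ x
    · exact Or.inl ⟨κ, rfl, hc⟩
    · exact absurd (h κ x hc) hκ
  · by_cases hc : IsCombBondAt ρ N l y
    · exact Or.inr ⟨l, rfl, hc⟩
    · exact absurd (h l y hc) hl

/-- [folklore] **COMB-STABILITY OF THE RELATIVE INVERSE ACROSS SLOTS**: `RelInv A (bhKOf lin N) (axEc ρ N)`, both slots spread, `A` spread,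
and agreement of `lin`, `lin′` off the comb bonds ⟹ `RelInv A (bhKOf lin′ N) (axEc ρ N)` (`relInv_of_combSupported_sub` BY NAME). -/
theorem relInv_bhKOf_of_agree {ρ : Fin (d + 1) → ℤ} {A : MKer (d + 1) (Fib d)} (hA : Spr A) (hM : Spr (bhKOf d lin N))
    (hM' : Spr (bhKOf d lin' N)) (hR : RelInv A (bhKOf d lin N) (axEc ρ N))
    (h : ∀ (κ : Fin (d + 1)) (x : Fin (d + 1) → ℤ), ¬ IsCombBondAt ρ N κ x → lin' (delta1 κ x) = lin (delta1 κ x)) :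
    RelInv A (bhKOf d lin' N) (axEc ρ N) :=
  relInv_of_combSupported_sub hA hM hM' hR (combSupported_bhKOf_sub_of_agree h)

/-- [folklore] **THE ROOTED∕STRAIGHT PAIR AS AN INSTANCE**: off the comb bonds `linAvgAt (toSite r) (delta1 κ x) N = contourSum N (delta1 κ x)`
(`linAvgAt_delta1_of_not_isCombBond`), so `relInv_bhKOf_of_agree` carries `RelInv A (bhK N) E` to `RelInv A (bhKAt (toSite r) N) E` along the
two bridges — the route of `relInv_coDressKBmAt_KInv_bhKAt`, now for ANY spread `A`. -/
theorem relInv_bhKAt_of_relInv_bhK [NeZero N] {r : Fin (d + 1) → ℕ} (hr : r ∈ box (d + 1) N) {A : MKer (d + 1) (Fib d)} (hA : Spr A)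
    (hR : RelInv A (bhK (d := d) N) (axEc (toSite r) N)) : RelInv A (bhKAt d (toSite r) N) (axEc (toSite r) N) := by
  have hN : 1 ≤ N := one_le_of_neZero N
  rw [← bhKOf_contourSum] at hR
  rw [← bhKOf_linAvgAt]
  refine relInv_bhKOf_of_agree hA ?_ ?_ hR fun κ x hc => ?_
  · rw [bhKOf_contourSum]; exact spr_bhK hN
  · exact spr_bhKAt hN hr
  · funext l y'
    exact linAvgAt_delta1_of_not_isCombBond hN hr hc l y'

end Diff

end

end Summit.QuantumFields.BalabanUV.Beta.BorderedHessian
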